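import Literature.NumberTheory.EllipticCurves.BSDConductorProofs
import Literature.NumberTheory.EllipticCurves.HasseWeilAbelianInertiaInvariantsProofs
import Literature.NumberTheory.EllipticCurves.TateModuleUnipotentInertiaProofs
import Literature.NumberTheory.EllipticCurves.WeilPairingProofs
import HarnessLib

/-!
# bsd.S15, numerical form, for `E/ℚ` from the reduced set of leaves (semistable: Serre–Tate + Weil pairing)

Sibling proof file (theorems only) of `BSDConductor` / `BSDConductorProofs`, companion of
`BSDConductorIdealFormProofs` and `TateModuleUnipotentInertiaProofs` (which do the same for the
ideal form `Literature.NumberTheory.EllipticCurves.conductor_eq_conductorOf_mul`).  Target: the corrected numerical bsd.S15 fact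
`Literature.BSD.conductorNorm_eq_artinConductorNat_of_isElliptic W ℓ` (`N_E = N^{(ℓ)}(V_ℓ E)` for
`ℓ ∤ N_E`, elliptic `W / ℚ`; Silverman *ATAEC* §IV.10–11, Serre–Tate 1968 §2.1), which
`BSDConductorProofs` reduces to the C15 fact
`WeierstrassCurve.artinConductorExponent_tate_eq_conductorExponent_of_isElliptic W ℓ`
(`conductorNorm_eq_artinConductorNat_of_isElliptic_of_tate`).  With the tree's theorems

* Silverman *ATAEC* Thm. IV.10.2(b) at the multiplicative places from 10.2(a) there and the Weil
  pairings (`TateModuleUnipotentInertiaProofs`: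
  `swanConductorAt_rationalTate_eq_zero_of_hasMultiplicativeReductionAt_of_codim_of_weilPairing`,
  unipotent inertia is tame), and
* Thm. IV.10.2(a) at the bad places from Serre–Tate's fundamental isomorphism
  `(V_ℓ E)^{I_𝔓} ≅ V_ℓ(Ẽ_ns(k̄_v))` (`HasseWeilAbelianInertiaInvariantsProofs`:
  `codimFixed_inertia_rationalTate_eq_{one,two}_of_…_of_serreTate`),

the numerical fact follows

* `conductorNorm_eq_artinConductorNat_of_isElliptic_of_codim_of_ogg_of_weilPairing` — from the two
  bad-place cases of 10.2(a) (`hTm`, `hTa`), Ogg's formula IV.11.1 at the additive places (`hWa`)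
  and the Weil pairings on `E[ℓⁿ]` (`hW`, *AEC* III.8.1);
* `conductorNorm_eq_artinConductorNat_of_isElliptic_of_isSemistable_of_codim_of_weilPairing` — for
  a **semistable** `E/ℚ`, from the multiplicative case of 10.2(a) and the Weil pairings only;
* `conductorNorm_eq_artinConductorNat_of_isElliptic_of_serreTate_of_ogg_of_weilPairing`,
  `…_of_isSemistable_of_serreTate_of_weilPairing` — the same with 10.2(a) replaced by Serre–Tate's
  fundamental isomorphism (`hST`,
  `WeierstrassCurve.nonempty_fixedSubmodule_inertia_rationalTate_equiv_reductionPoints`).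

So for a semistable elliptic curve over `ℚ` the statement "`N_E` is the (prime-to-`ℓ`) Artin
conductor of `V_ℓ E`" rests on exactly two named facts of the tree: Serre–Tate's lemma
(*ATAEC* p. 359; Serre–Tate 1968, §1) and the existence of the Weil pairing (*AEC* III.8.1).

## Update (2026-08-14): the Weil pairing is discharged

The existence of the Weil pairings (`WeierstrassCurve.exists_weilPairing W m`, Silverman *AEC*
III.8.1) is now a theorem of the tree (`WeierstrassCurve.exists_weilPairing_holds`,
`WeilPairingProofs`), so the hypothesis `hW` of the reductions above is fed once and for all
(section `WeilPairingDischarged`):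

* `WeierstrassCurve.swanConductorAt_rationalTate_eq_zero_of_hasMultiplicativeReductionAt_of_codim`
  — over any number field `K`, Silverman *ATAEC* Thm. IV.10.2(b) at the multiplicative places
  (the named fact `swanConductorAt_rationalTate_eq_zero_of_hasMultiplicativeReductionAt W ℓ`)
  follows from Thm. IV.10.2(a) there
  (`codimFixed_inertia_rationalTate_eq_one_of_hasMultiplicativeReductionAt W ℓ`) **alone**, and
  `…_of_serreTate` from Serre–Tate's fundamental isomorphism alone; likewise the C15 fact
  `artinConductorExponent_tate_eq_conductorExponent_of_isElliptic W ℓ` from the three remaining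
  leaves (`…_of_codim_of_ogg`, `…_of_serreTate_of_ogg`) and, for semistable `W`, from the single
  multiplicative tame leaf (`…_of_isSemistable_of_codim`, `…_of_isSemistable_of_serreTate'`);
* over `ℚ`: `conductorNorm_eq_artinConductorNat_of_isElliptic_of_codim_of_ogg`,
  `…_of_serreTate_of_ogg`, `…_of_isSemistable_of_codim`, `…_of_isSemistable_of_serreTate`.

So the corrected bsd.S15 fact `Literature.BSD.conductorNorm_eq_artinConductorNat_of_isElliptic W ℓ`
now rests on exactly **two** named facts of the tree — Serre–Tate's lemma
`nonempty_fixedSubmodule_inertia_rationalTate_equiv_reductionPoints` (*ATAEC* p. 359) and Ogg's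
formula for the wild part at the additive places
`swanConductorAt_rationalTate_eq_wildConductorExponent_of_hasAdditiveReductionAt` (*ATAEC*
IV.11.1; Ogg 1967, Saito 1988) — and for a semistable `E/ℚ` on the first alone.

## References

* J. H. Silverman, *Advanced Topics in the Arithmetic of Elliptic Curves*, GTM 151 (1994), §IV.10,
  Thm. 10.2 and its proof (PDF pp. 358–360), Definition of the conductor (p. 364), §IV.11
  (Ogg's formula 11.1, p. 365). [SilvermanATAEC1994]
* J. H. Silverman, *The Arithmetic of Elliptic Curves*, 2nd ed. (2009), Prop. III.8.1.
  [SilvermanAEC2009]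
* J.-P. Serre, J. Tate, *Good reduction of abelian varieties*, Ann. of Math. 88 (1968), §1, §2.1,
  §3. [SerreTate1968]
-/

noncomputable section

open scoped Classical NumberField
open IsDedekindDomain WeierstrassCurve

namespace Literature.NumberTheory.EllipticCurves

variable (W : WeierstrassCurve ℚ) (ℓ : ℕ) [Fact ℓ.Prime]

/-- **bsd.S15 (numerical, corrected) from Thm. IV.10.2(a), Ogg's formula at the additive places
and the Weil pairings.**  For an elliptic curve `E/ℚ`: `N_E = N^{(ℓ)}(V_ℓ E)` for `ℓ ∤ N_E`
(`conductorNorm_eq_artinConductorNat_of_isElliptic W ℓ`) follows from the multiplicative and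
additive cases of Silverman *ATAEC* Thm. IV.10.2(a) (`hTm`, `hTa`), Ogg's formula IV.11.1 for the
wild part at the additive places (`hWa`) and the Weil pairings on `E[ℓⁿ]` (`hW`; they give
`det ρ_ℓ = χ_ℓ` and thereby 10.2(b) at the multiplicative places,
`TateModuleUnipotentInertiaProofs`).  Ideal-form analogue:
`conductor_eq_conductorOf_mul_of_codim_of_ogg_of_weilPairing`.
[cite: SilvermanATAEC1994, Thm. IV.10.2 and IV.11.1 (PDF pp. 358–366) with §IV.10 Definition of the conductor (p. 364)] -/
theorem conductorNorm_eq_artinConductorNat_of_isElliptic_of_codim_of_ogg_of_weilPairing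
    (hTm : W.codimFixed_inertia_rationalTate_eq_one_of_hasMultiplicativeReductionAt ℓ)
    (hTa : W.codimFixed_inertia_rationalTate_eq_two_of_hasAdditiveReductionAt ℓ)
    (hWa : W.swanConductorAt_rationalTate_eq_wildConductorExponent_of_hasAdditiveReductionAt ℓ)
    (hW : ∀ n : ℕ, W.exists_weilPairing (ℓ ^ (n + 1))) :
    conductorNorm_eq_artinConductorNat_of_isElliptic W ℓ :=
  conductorNorm_eq_artinConductorNat_of_isElliptic_of_tate W ℓ
    (W.artinConductorExponent_tate_eq_conductorExponent_of_isElliptic_of_codim_of_ogg_of_weilPairing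
      ℓ hTm hTa hWa hW)

/-- **bsd.S15 (numerical) for semistable `E/ℚ` from 10.2(a) at the multiplicative places and the
Weil pairings.**  For a semistable elliptic curve `E/ℚ`, `N_E = N^{(ℓ)}(V_ℓ E)` for `ℓ ∤ N_E`
follows from the multiplicative case of Silverman *ATAEC* Thm. IV.10.2(a) (`hTm`) and the Weil
pairings (`hW`) alone.  Ideal-form analogue:
`conductor_eq_conductorOf_mul_of_isSemistable_of_codim_of_weilPairing`.
[cite: SilvermanATAEC1994, Thm. IV.10.2(a),(b) (PDF p. 358) with §IV.10 Definition of the conductor (p. 364)] -/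
theorem conductorNorm_eq_artinConductorNat_of_isElliptic_of_isSemistable_of_codim_of_weilPairing
    (hs : W.IsSemistable (𝓞 ℚ))
    (hTm : W.codimFixed_inertia_rationalTate_eq_one_of_hasMultiplicativeReductionAt ℓ)
    (hW : ∀ n : ℕ, W.exists_weilPairing (ℓ ^ (n + 1))) :
    conductorNorm_eq_artinConductorNat_of_isElliptic W ℓ :=
  conductorNorm_eq_artinConductorNat_of_isElliptic_of_tate W ℓ
    (W.artinConductorExponent_tate_eq_conductorExponent_of_isSemistable_of_codim_of_weilPairing
      ℓ hs hTm hW)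

/-- **bsd.S15 (numerical, corrected) from Serre–Tate's fundamental isomorphism, Ogg's formula at
the additive places and the Weil pairings**: 10.2(a) at the bad places is supplied by
`codimFixed_inertia_rationalTate_eq_{one,two}_of_…_of_serreTate`
(`HasseWeilAbelianInertiaInvariantsProofs`).
[cite: SilvermanATAEC1994, Thm. IV.10.2 and IV.11.1 with the proof of 10.2(a) (PDF pp. 358–366)] -/
theorem conductorNorm_eq_artinConductorNat_of_isElliptic_of_serreTate_of_ogg_of_weilPairing
    (hST : W.nonempty_fixedSubmodule_inertia_rationalTate_equiv_reductionPoints ℓ)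
    (hWa : W.swanConductorAt_rationalTate_eq_wildConductorExponent_of_hasAdditiveReductionAt ℓ)
    (hW : ∀ n : ℕ, W.exists_weilPairing (ℓ ^ (n + 1))) :
    conductorNorm_eq_artinConductorNat_of_isElliptic W ℓ :=
  conductorNorm_eq_artinConductorNat_of_isElliptic_of_codim_of_ogg_of_weilPairing W ℓ
    (W.codimFixed_inertia_rationalTate_eq_one_of_hasMultiplicativeReductionAt_of_serreTate ℓ hST)
    (W.codimFixed_inertia_rationalTate_eq_two_of_hasAdditiveReductionAt_of_serreTate ℓ hST) hWa hW

/-- **bsd.S15 (numerical) for semistable `E/ℚ` from Serre–Tate's fundamental isomorphism and the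
Weil pairings alone.**  For a semistable elliptic curve `E/ℚ` and a prime `ℓ`,
`N_E = N^{(ℓ)}(V_ℓ E)` for `ℓ ∤ N_E` follows from the two named facts
`WeierstrassCurve.nonempty_fixedSubmodule_inertia_rationalTate_equiv_reductionPoints W ℓ`
(Serre–Tate 1968, §1; Silverman *ATAEC* p. 359) and `WeierstrassCurve.exists_weilPairing W (ℓ^n)`
(Silverman *AEC* III.8.1). [cite: SilvermanATAEC1994, Thm. IV.10.2(a),(b) and their proof (PDF pp. 358–360)] -/
theorem conductorNorm_eq_artinConductorNat_of_isElliptic_of_isSemistable_of_serreTate_of_weilPairing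
    (hs : W.IsSemistable (𝓞 ℚ))
    (hST : W.nonempty_fixedSubmodule_inertia_rationalTate_equiv_reductionPoints ℓ)
    (hW : ∀ n : ℕ, W.exists_weilPairing (ℓ ^ (n + 1))) :
    conductorNorm_eq_artinConductorNat_of_isElliptic W ℓ :=
  conductorNorm_eq_artinConductorNat_of_isElliptic_of_isSemistable_of_codim_of_weilPairing W ℓ hs
    (W.codimFixed_inertia_rationalTate_eq_one_of_hasMultiplicativeReductionAt_of_serreTate ℓ hST) hW

end Literature.NumberTheory.EllipticCurves

/-! ### The Weil pairing discharged (`WeierstrassCurve.exists_weilPairing_holds`) -/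

section WeilPairingDischarged

namespace WeierstrassCurve

open Literature.NumberTheory.EllipticCurves Field

universe u

variable {K : Type u} [Field K] [NumberField K] (W : WeierstrassCurve K) (ℓ : ℕ) [Fact ℓ.Prime]

/-- **Silverman *ATAEC* Thm. IV.10.2(b) at the multiplicative places from Thm. IV.10.2(a) there,
unconditionally in the Weil pairing.**  For an elliptic curve `E/K` over a number field and a
prime `ℓ`, the named fact `swanConductorAt_rationalTate_eq_zero_of_hasMultiplicativeReductionAt W ℓ`
(`Sw_𝔓(V_ℓ E) = 0` at the places `v ∤ ℓ` of multiplicative reduction: *"If `E/K` has good or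
multiplicative reduction … then `δ(E/K) = 0`"*, PDF p. 358) follows from the multiplicative case
of Thm. IV.10.2(a) (`codimFixed_inertia_rationalTate_eq_one_of_hasMultiplicativeReductionAt W ℓ`,
`codim (V_ℓ E)^{I_𝔓} = 1`) alone: the Weil pairings required by
`swanConductorAt_rationalTate_eq_zero_of_hasMultiplicativeReductionAt_of_codim_of_weilPairing`
(`TateModuleUnipotentInertiaProofs`: unipotent inertia is tame, `det ρ_ℓ = χ_ℓ`) are the theorem
`exists_weilPairing_holds` (*AEC* III.8.1, `WeilPairingProofs`).
[cite: SilvermanATAEC1994, Thm. IV.10.2(b) (PDF pp. 358–360)] -/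
theorem swanConductorAt_rationalTate_eq_zero_of_hasMultiplicativeReductionAt_of_codim
    (hTm : W.codimFixed_inertia_rationalTate_eq_one_of_hasMultiplicativeReductionAt ℓ) :
    W.swanConductorAt_rationalTate_eq_zero_of_hasMultiplicativeReductionAt ℓ :=
  W.swanConductorAt_rationalTate_eq_zero_of_hasMultiplicativeReductionAt_of_codim_of_weilPairing ℓ
    hTm fun n ↦ W.exists_weilPairing_holds (ℓ ^ (n + 1))

/-- **Thm. IV.10.2(b) at the multiplicative places from Serre–Tate's fundamental isomorphism
alone**: `swanConductorAt_rationalTate_eq_zero_of_hasMultiplicativeReductionAt W ℓ` from the named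
fact `nonempty_fixedSubmodule_inertia_rationalTate_equiv_reductionPoints W ℓ`
(`(V_ℓ E)^{I_𝔓} ≅ V_ℓ(Ẽ_ns(k̄_v))`, *ATAEC* p. 359), which gives 10.2(a) at the multiplicative
places (`codimFixed_inertia_rationalTate_eq_one_of_hasMultiplicativeReductionAt_of_serreTate`,
`HasseWeilAbelianInertiaInvariantsProofs`).
[cite: SilvermanATAEC1994, Thm. IV.10.2(a),(b) and the proof of (a) (PDF pp. 358–360)] -/
theorem swanConductorAt_rationalTate_eq_zero_of_hasMultiplicativeReductionAt_of_serreTate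
    (hST : W.nonempty_fixedSubmodule_inertia_rationalTate_equiv_reductionPoints ℓ) :
    W.swanConductorAt_rationalTate_eq_zero_of_hasMultiplicativeReductionAt ℓ :=
  W.swanConductorAt_rationalTate_eq_zero_of_hasMultiplicativeReductionAt_of_codim ℓ
    (W.codimFixed_inertia_rationalTate_eq_one_of_hasMultiplicativeReductionAt_of_serreTate ℓ hST)

/-- **The C15 fact from the three remaining leaves.**  Ogg–Saito in Galois form,
`artinConductorExponent_tate_eq_conductorExponent_of_isElliptic W ℓ` (`a_v(V_ℓ E) = f_v(E)`,
`v ∤ ℓ`), follows from Thm. IV.10.2(a) at the multiplicative and additive places (`hTm`, `hTa`)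
and Ogg's formula IV.11.1 for the wild part at the additive places (`hWa`); the fourth leaf,
10.2(b) at the multiplicative places, is
`swanConductorAt_rationalTate_eq_zero_of_hasMultiplicativeReductionAt_of_codim`.
[cite: SilvermanATAEC1994, Thm. IV.10.2 and Thm. IV.11.1 (PDF pp. 358–366)] -/
theorem artinConductorExponent_tate_eq_conductorExponent_of_isElliptic_of_codim_of_ogg
    (hTm : W.codimFixed_inertia_rationalTate_eq_one_of_hasMultiplicativeReductionAt ℓ)
    (hTa : W.codimFixed_inertia_rationalTate_eq_two_of_hasAdditiveReductionAt ℓ)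
    (hWa : W.swanConductorAt_rationalTate_eq_wildConductorExponent_of_hasAdditiveReductionAt ℓ) :
    W.artinConductorExponent_tate_eq_conductorExponent_of_isElliptic ℓ :=
  W.artinConductorExponent_tate_eq_conductorExponent_of_isElliptic_of_facts ℓ hTm hTa
    (W.swanConductorAt_rationalTate_eq_zero_of_hasMultiplicativeReductionAt_of_codim ℓ hTm) hWa

/-- **The C15 fact from Serre–Tate's fundamental isomorphism and Ogg's formula at the additive
places** (the two named facts of the tree on which it now rests).
[cite: SilvermanATAEC1994, Thm. IV.10.2, its proof, and Thm. IV.11.1 (PDF pp. 358–366)] -/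
theorem artinConductorExponent_tate_eq_conductorExponent_of_isElliptic_of_serreTate_of_ogg
    (hST : W.nonempty_fixedSubmodule_inertia_rationalTate_equiv_reductionPoints ℓ)
    (hWa : W.swanConductorAt_rationalTate_eq_wildConductorExponent_of_hasAdditiveReductionAt ℓ) :
    W.artinConductorExponent_tate_eq_conductorExponent_of_isElliptic ℓ :=
  W.artinConductorExponent_tate_eq_conductorExponent_of_isElliptic_of_codim_of_ogg ℓ
    (W.codimFixed_inertia_rationalTate_eq_one_of_hasMultiplicativeReductionAt_of_serreTate ℓ hST)
    (W.codimFixed_inertia_rationalTate_eq_two_of_hasAdditiveReductionAt_of_serreTate ℓ hST) hWa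

/-- **The C15 fact for semistable curves from the single multiplicative tame leaf.**  For a
semistable `W` over a number field, `artinConductorExponent_tate_eq_conductorExponent_of_isElliptic W ℓ`
follows from `codimFixed_inertia_rationalTate_eq_one_of_hasMultiplicativeReductionAt W ℓ`
(Silverman *ATAEC* Thm. IV.10.2(a), multiplicative case) alone.
[cite: SilvermanATAEC1994, Thm. IV.10.2 and Example 10.5 (PDF pp. 358–364)] -/
theorem artinConductorExponent_tate_eq_conductorExponent_of_isSemistable_of_codim
    (hs : W.IsSemistable (𝓞 K))
    (hTm : W.codimFixed_inertia_rationalTate_eq_one_of_hasMultiplicativeReductionAt ℓ) :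
    W.artinConductorExponent_tate_eq_conductorExponent_of_isElliptic ℓ :=
  W.artinConductorExponent_tate_eq_conductorExponent_of_isElliptic_of_isSemistable ℓ hs hTm
    (W.swanConductorAt_rationalTate_eq_zero_of_hasMultiplicativeReductionAt_of_codim ℓ hTm)

/-- **The C15 fact for semistable curves from Serre–Tate's fundamental isomorphism alone.**
[cite: SilvermanATAEC1994, Thm. IV.10.2(a),(b) and the proof of (a) (PDF pp. 358–360)] -/
theorem artinConductorExponent_tate_eq_conductorExponent_of_isSemistable_of_serreTate'
    (hs : W.IsSemistable (𝓞 K))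
    (hST : W.nonempty_fixedSubmodule_inertia_rationalTate_equiv_reductionPoints ℓ) :
    W.artinConductorExponent_tate_eq_conductorExponent_of_isElliptic ℓ :=
  W.artinConductorExponent_tate_eq_conductorExponent_of_isSemistable_of_codim ℓ hs
    (W.codimFixed_inertia_rationalTate_eq_one_of_hasMultiplicativeReductionAt_of_serreTate ℓ hST)

end WeierstrassCurve

namespace Literature.NumberTheory.EllipticCurves

open WeierstrassCurve

variable (W : WeierstrassCurve ℚ) (ℓ : ℕ) [Fact ℓ.Prime]

/-- **bsd.S15 (numerical, corrected) from the three remaining leaves.**  For an elliptic curve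
`E/ℚ` and a prime `ℓ`, `N_E = N^{(ℓ)}(V_ℓ E)` for `ℓ ∤ N_E`
(`conductorNorm_eq_artinConductorNat_of_isElliptic W ℓ`) follows from Silverman *ATAEC*
Thm. IV.10.2(a) at the multiplicative and additive places (`hTm`, `hTa`) and Ogg's formula IV.11.1
for the wild part at the additive places (`hWa`) — the Weil-pairing hypothesis of
`conductorNorm_eq_artinConductorNat_of_isElliptic_of_codim_of_ogg_of_weilPairing` being the theorem
`exists_weilPairing_holds`.
[cite: SilvermanATAEC1994, Thm. IV.10.2 and IV.11.1 (PDF pp. 358–366) with §IV.10 Definition of the conductor (p. 364)] -/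
theorem conductorNorm_eq_artinConductorNat_of_isElliptic_of_codim_of_ogg
    (hTm : W.codimFixed_inertia_rationalTate_eq_one_of_hasMultiplicativeReductionAt ℓ)
    (hTa : W.codimFixed_inertia_rationalTate_eq_two_of_hasAdditiveReductionAt ℓ)
    (hWa : W.swanConductorAt_rationalTate_eq_wildConductorExponent_of_hasAdditiveReductionAt ℓ) :
    conductorNorm_eq_artinConductorNat_of_isElliptic W ℓ :=
  conductorNorm_eq_artinConductorNat_of_isElliptic_of_tate W ℓ
    (W.artinConductorExponent_tate_eq_conductorExponent_of_isElliptic_of_codim_of_ogg ℓ hTm hTa hWa)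

/-- **bsd.S15 (numerical, corrected) from Serre–Tate's fundamental isomorphism and Ogg's formula
at the additive places** — the two named facts of the tree on which
`conductorNorm_eq_artinConductorNat_of_isElliptic W ℓ` now rests.
[cite: SilvermanATAEC1994, Thm. IV.10.2, its proof, and Thm. IV.11.1 (PDF pp. 358–366) with §IV.10 Definition of the conductor (p. 364)] -/
theorem conductorNorm_eq_artinConductorNat_of_isElliptic_of_serreTate_of_ogg
    (hST : W.nonempty_fixedSubmodule_inertia_rationalTate_equiv_reductionPoints ℓ)
    (hWa : W.swanConductorAt_rationalTate_eq_wildConductorExponent_of_hasAdditiveReductionAt ℓ) :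
    conductorNorm_eq_artinConductorNat_of_isElliptic W ℓ :=
  conductorNorm_eq_artinConductorNat_of_isElliptic_of_tate W ℓ
    (W.artinConductorExponent_tate_eq_conductorExponent_of_isElliptic_of_serreTate_of_ogg ℓ hST hWa)

/-- **bsd.S15 (numerical) for semistable `E/ℚ` from 10.2(a) at the multiplicative places
alone.**  For a semistable elliptic curve `E/ℚ` and a prime `ℓ`, `N_E = N^{(ℓ)}(V_ℓ E)` for
`ℓ ∤ N_E` follows from `codimFixed_inertia_rationalTate_eq_one_of_hasMultiplicativeReductionAt W ℓ`
(Silverman *ATAEC* Thm. IV.10.2(a), multiplicative case) alone.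
[cite: SilvermanATAEC1994, Thm. IV.10.2(a),(b) (PDF p. 358) with §IV.10 Definition of the conductor (p. 364)] -/
theorem conductorNorm_eq_artinConductorNat_of_isElliptic_of_isSemistable_of_codim
    (hs : W.IsSemistable (𝓞 ℚ))
    (hTm : W.codimFixed_inertia_rationalTate_eq_one_of_hasMultiplicativeReductionAt ℓ) :
    conductorNorm_eq_artinConductorNat_of_isElliptic W ℓ :=
  conductorNorm_eq_artinConductorNat_of_isElliptic_of_tate W ℓ
    (W.artinConductorExponent_tate_eq_conductorExponent_of_isSemistable_of_codim ℓ hs hTm)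

/-- **bsd.S15 (numerical) for semistable `E/ℚ` from Serre–Tate's fundamental isomorphism
alone.**  For a semistable elliptic curve `E/ℚ` and a prime `ℓ`, `N_E = N^{(ℓ)}(V_ℓ E)` for
`ℓ ∤ N_E` follows from the single named fact
`WeierstrassCurve.nonempty_fixedSubmodule_inertia_rationalTate_equiv_reductionPoints W ℓ`
(Serre–Tate 1968, §1 Lemma 2; Silverman *ATAEC*, proof of Thm. IV.10.2(a), PDF p. 359).
[cite: SilvermanATAEC1994, Thm. IV.10.2(a),(b) and the proof of (a) (PDF pp. 358–360)] -/
theorem conductorNorm_eq_artinConductorNat_of_isElliptic_of_isSemistable_of_serreTate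
    (hs : W.IsSemistable (𝓞 ℚ))
    (hST : W.nonempty_fixedSubmodule_inertia_rationalTate_equiv_reductionPoints ℓ) :
    conductorNorm_eq_artinConductorNat_of_isElliptic W ℓ :=
  conductorNorm_eq_artinConductorNat_of_isElliptic_of_tate W ℓ
    (W.artinConductorExponent_tate_eq_conductorExponent_of_isSemistable_of_serreTate' ℓ hs hST)

end Literature.NumberTheory.EllipticCurves

end WeilPairingDischarged

end
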